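import Summits.ABC.IUTFork.Repair.CandInternal2RealLabelsLicenceGenuineK
import HarnessLib

/-!
# IUT REPAIR branch → R-H ROUND 1 (D-0079 / D-0107), candidate row 5 «tame-band-licence»: the deciding decl `HStarTameBandLicence`
# typed over the genuine `K`-level datum `Cor312Prov.pilotDataOfK D K`, its k1 evaluation cells, and its DECLARED stratum-equivalence
# with the (xi-f) licence at `Thm311.Real.settingPrVolSharp (pilotDataOfK D K) …` on the tame stratum

Seat abc-iut-rh-typ-5 (R-H ROUND 1 PAIR n = 5 TYPER; tester abc-iut-rh-tst-5; k2 desk hand abc-iut-w5-d068; plan/rescue/R-H/RH-CANDIDATES.tsv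
row 5, START-HERE.md v1.3 §3/§8). HONEST FRAMING: `HStarTameBandLicence` is an R-H CANDIDATE HYPOTHESIS (a claim-tagged `def … : Prop`),
never a Literature fact; nothing here asserts abc proved or refuted; no side is taken on [IUTchIII] Cor. 3.12 or on any author; typed ≠ proved;
refuted-as-typed ≠ refuted-in-print. Everything arithmetic is consumed BY NAME from abc-iut-w5-d009 (`Thm311.Real.tame_exact_iff_emod`,
`tame_exact_of_sufficient_leg`, `necessary_leg_of_tame_exact`, `Cor312Prov.licence_settingPrVolSharp_pilotDataOfK_iff_of_tame`,
`exists_qPinned_and_hull_settingPrVolSharp_iff_licence`), abc-iut-w5-d068 (`CandInternal2RealLabelsLicence(GenuineK)`: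
`mem_pow_smul_logShell_qIdele_pilotDataOfK_iff_of_tame`), abc-iut-w5-d236 (`norm_qIdele_le_one_of_realises`), abc-iut-C-cert
(`Cor312Prov.exists_nat_qPilot_pilotDataOfK`); the band-top sufficient half is abc-iut-rp-s2's `RHBandTopTame` (p457138).

THE CANDIDATE ROW (verbatim, RH-CANDIDATES.tsv v1 row 5, informal_statement): «on TAME bad packets (e_w < p-1, or ball places): forall j:
(j^2-1)*m_q <= j*(e_w-1) + ((j^2*m_q - 1) mod e_w) (theta_j = j end of the band); no claim at wild packets»; stratum/scope: «tame stratum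
only»; k1_recipe: «licence_cell_tame(p448597-form) column (v2.1) per cell; datum verdict on tame rows only; report n/N over TAME rows + ceiling»;
k4: «vs I06*: S-X72 (e=2, l=5, H=5: I06* NEG, H* POS); vs S_H: EQUAL on the tame stratum BY THEOREM (declared stratum-equivalence, allowed)».

WHAT IS TYPED / PROVED (namespace `Summit.ABC.IUTFork.Repair.RH.TameBandLicence`):
* §1 `Cell e P j` — the integer cell `(j²−1)·P ≤ j·(e−1) + ((j²·P − 1) mod e)`; `cell_iff_tame_exact` (= w5-d009's exact tame predicate
  `e·((j²P−1) div e) + 1 − j(e−1) ≤ P`); `cell_of_bandTop` (SUFFICIENT half θ_j = j: `(j²−1)P ≤ j(e−1)`); `cell_of_quadratic` (the I06⋆ tame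
  cell `(j²−1)P ≤ e−1` implies it: H⋆ is WEAKER than I06⋆); `linear_of_cell` (it implies the LINEAR cell `(j−1)P ≤ e−1`); `not_cell_one`
  (at `e = 1` it FAILS for every `j ≥ 2`, `P ≥ 1` — the unramified-odd stratum); `k4_witnesses`; k1 kernel blocks `k1_cells_v21` (the 22 tame
  cells of I06STAR-COLUMNS v2.1 = 18 distinct `(e, P, j)`), `k1_cells_frey_sample`.
* §2 **`HStarTameBandLicence D`** — the deciding decl: at every bad place `w ∣ p` of `pilotDataOfK D K` that is TAME (`p > 2`,
  `e_w = e(w|p) ≤ p − 2`) and every label `j = i+1 ∈ 𝔽_l^⋇`, with `P_w ∈ ℕ` the integral q-degree (`qPilot w = P_w`, [IUTchI] Ex. 3.2 (iv)):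
  `Cell e_w P_w j`. No claim at wild / boundary packets (vacuous there). The row's «or ball places» rider (boundary places `e_w = p − 1`
  without `ζ_p`) is NOT typed: the tree has no licence decision at such packets (out of scope, said here, not hidden).
* §3 at the window bed, all bad fibres uniformly tame, Θ- and q-ideles REALISING the pilot divisors:
  **`licence_settingPrVolSharp_pilotDataOfK_iff_hStar_of_tame`** (`Thm311ToCor312.Licence (settingPrVolSharp (pilotDataOfK D K) …) ↔ H⋆` —
  the DECLARED stratum-equivalence, START-HERE §3 k4 amended), **`exists_qPinned_and_hull_settingPrVolSharp_pilotDataOfK_of_hStar_of_tame`**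
  (H⋆ ⟹ branch C's per-datum S_H antecedent «∃ ρ qK, QPinned ∧ PilotKummerCompatHull», the k2 target shape / §8 A2 (a) door),
  `hStar_of_realStar_tame` (the REAL I06⋆ cells at the tame bad places ⟹ H⋆: weaker than I06⋆), `not_hStar_of_unramified_bad` (a bad place
  with `e_w = 1` refutes H⋆ as typed — AGREEING with `CandInternal2Real.not_mem_jsq_smul_logShell_of_unramified` and with the licence's own
  refutation there: the (L2) ceiling, not a false positive).
READING (numbers, not adjectives): on the tame stratum H⋆ IS the licence cell by theorem, so k1(H⋆) = the (L2) CEILING exactly (ceiling-tight);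
its content is T-d faithfulness of the band end `θ_j = j` ([IUTchIV] Prop. 1.2 (i)(ii) multi-slot factor) and nothing on the wild stratum.
[cite: Mochizuki2012, IUTchI Def. 3.1 (b),(c) pp. 61–62, Ex. 3.2 (iv) p. 71; IUTchIII Cor. 3.12 p. 173–174, Step (xi-f) p. 184; IUTchIV Prop. 1.2 (i)(ii) p. 10]
[cite: MochizukiAbsTopIII2015, Def 5.4 (iii) p. 126] [cite: DupuyHilado2025, §3.3, §3.4, §3.9, §4.9] [claim: Mochizuki2012, status: disputed]
for every IUT sentence quoted. Axioms: standard. No instance, no notation.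
-/

noncomputable section

open Set Metric Function NumberField IsDedekindDomain
open scoped Pointwise

namespace Summit.ABC.IUTFork.Repair.RH.TameBandLicence

open Literature.AnabelianGeometry.AbsoluteAnabelian Literature.IUT.LogThetaLattice Literature.IUT.LogVolume
  Literature.IUT.HodgeTheaters Literature.NumberTheory.NumberFields Literature.NumberTheory.GaloisRepresentations.Ultrametric
open Summit.ABC.IUTFork.Thm311 Summit.ABC.IUTFork.Thm311.Real Summit.ABC.IUTFork.Cor312 Summit.ABC.IUTFork.Cor312.Setting
  Summit.ABC.IUTFork.Cor312Vol Summit.ABC.IUTFork.Cor312Prov Summit.ABC.IUTFork.Repair.CandInternal2RealLabels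
  Summit.ABC.IUTFork.Repair.CandInternal2RealLabelsLicence Summit.ABC.IUTFork.Repair.CandInternal2RealLabelsLicenceGenuineK

/-! ## §1. The cell in integer currency and its k1 evaluation -/

/-- **The H⋆₅ cell «tame-band-licence» at one (place, label)** in integer currency (`e = e_w` the absolute ramification index, `P = m_q(w)`
the integral q-degree, `j` the label): `(j² − 1)·P ≤ j·(e − 1) + ((j²·P − 1) mod e)` — the `θ_j = j` end of the (L1) band
`(j²−1)·m_q ≤ θ_j·(e−1)` corrected by the floor resonance `r_j = (j²·m_q − 1) mod e`. [R-H candidate cell, hypothesis — not a fact]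
[cite: DupuyHilado2025, §3.4, §4.9] [claim: Mochizuki2012, status: disputed] -/
@[claim "Mochizuki2012" "disputed"]
def Cell (e P j : ℤ) : Prop :=
  (j ^ 2 - 1) * P ≤ j * (e - 1) + (j ^ 2 * P - 1) % e

/-- Unfolding lemma for `Cell`. [folklore] -/
theorem cell_iff (e P j : ℤ) : Cell e P j ↔ (j ^ 2 - 1) * P ≤ j * (e - 1) + (j ^ 2 * P - 1) % e := Iff.rfl

/-- **The cell IS abc-iut-w5-d009's exact tame licence predicate** `e·((j²P − 1) div e) + 1 − j(e−1) ≤ P` (`tame_exact_iff_emod`, p448597 /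
p449282 form; the `licence_cell_tame` column 37 of I06STAR-COLUMNS v2.1). [folklore] -/
theorem cell_iff_tame_exact {e : ℤ} (he : 0 < e) (P j : ℤ) :
    Cell e P j ↔ e * ((j ^ 2 * P - 1) / e) + 1 - j * (e - 1) ≤ P := by
  rw [tame_exact_iff_emod he j P, cell_iff]
  constructor <;> intro h <;> linarith

/-- **SUFFICIENT HALF (band top `θ_j = j`)**: `(j²−1)·P ≤ j·(e−1)` ⟹ the cell (the remainder is `≥ 0`; abc-iut-rp-s2 `RHBandTopTame.emod_leg_of_bandTop`
is the same inequality). [folklore] -/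
theorem cell_of_bandTop {e P j : ℤ} (he : e ≠ 0) (h : (j ^ 2 - 1) * P ≤ j * (e - 1)) : Cell e P j := by
  have h0 : 0 ≤ (j ^ 2 * P - 1) % e := Int.emod_nonneg _ he
  show _ ≤ _
  linarith

/-- **The I06⋆ tame cell implies the H⋆₅ cell** (`(j²−1)·P ≤ e−1 ≤ j·(e−1)`): on the tame stratum H⋆₅ is WEAKER than RP-I06⋆
(`CandInternal2RealLabelsLicence.mem_pow_smul_logShell_iff_int_of_tame`). [folklore] -/
theorem cell_of_quadratic {e P j : ℤ} (he : 1 ≤ e) (hj : 1 ≤ j) (h : (j ^ 2 - 1) * P ≤ e - 1) : Cell e P j := by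
  refine cell_of_bandTop (by omega) ?_
  have h1 : e - 1 ≤ j * (e - 1) := le_mul_of_one_le_left (by omega) hj
  linarith

/-- **The H⋆₅ cell implies the LINEAR shell cell** `(j−1)·P ≤ e−1` (abc-iut-w5-d009 `necessary_leg_of_tame_exact`). [folklore] -/
theorem linear_of_cell {e P j : ℤ} (he : 1 ≤ e) (hj : 1 ≤ j) (h : Cell e P j) : (j - 1) * P ≤ e - 1 :=
  necessary_leg_of_tame_exact he hj ((cell_iff_tame_exact (by omega) P j).1 h)

/-- **Unramified places (`e = 1`): the cell FAILS at every label `j ≥ 2` for every `P ≥ 1`** — H⋆₅ AGREES with the unramified-odd NEG family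
(`CandInternal2Real.not_mem_jsq_smul_logShell_of_unramified`) and with the licence's refutation there. [folklore] -/
theorem not_cell_one {P j : ℤ} (hP : 1 ≤ P) (hj : 2 ≤ j) : ¬ Cell 1 P j := by
  intro h
  have h1 := linear_of_cell le_rfl (by omega) h
  nlinarith [hP, hj, h1]

/-- At the label `j = 1` the cell ALWAYS holds (`e ≥ 1`: `0 ≤ e − 1 + (P − 1) mod e`). [folklore] -/
theorem cell_one_label {e P : ℤ} (he : 1 ≤ e) : Cell e P 1 := by
  have h0 : 0 ≤ (P - 1) % e := Int.emod_nonneg _ (by omega)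
  simp only [Cell, one_pow, sub_self, zero_mul, one_mul]
  linarith

/-- **k4 witnesses (integer side).** At S-X72's cell `(e, P, j) = (2, 1, 2)` and at HEX:2:5/HEX:3:5@p7.j2.ev1 `(5, 2, 2)`, `(5, 3, 2)` the
I06⋆ tame cell `(j²−1)·P ≤ e−1` FAILS while the H⋆₅ cell HOLDS (H⋆₅ strictly weaker than I06⋆); at HEX:4:5@p7.j2.ev1 `(5, 4, 2)` the LINEAR
cell `(j−1)·P ≤ e−1` holds while the H⋆₅ cell FAILS (strictly stronger than the linear shell). [folklore] -/
theorem k4_witnesses :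
    (Cell 2 1 2 ∧ ¬ (((2 : ℤ) ^ 2 - 1) * 1 ≤ 2 - 1)) ∧ (Cell 5 2 2 ∧ ¬ (((2 : ℤ) ^ 2 - 1) * 2 ≤ 5 - 1)) ∧
      (Cell 5 3 2 ∧ ¬ (((2 : ℤ) ^ 2 - 1) * 3 ≤ 5 - 1)) ∧ (¬ Cell 5 4 2 ∧ ((2 : ℤ) - 1) * 4 ≤ 5 - 1) := by
  simp only [Cell]
  decide

/-- **k1 KERNEL BLOCK, rows of record.** The 22 cells of stratum `tame` of plan/rescue/R-H/I06STAR-COLUMNS.tsv v2.1 (cols 1–30 = v1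
2e4c48fd4267a5a7): HEX:k:5@p7.j{1,2}.ev1 (`e = 5`, `P = m_q = e·H/(2l) = k`, `k ∈ {1,2,3,4,6,7,8,9}`), concrete X75 / X75i (`(5, 1, j)`), X72
(`(2, 1, j)`), `j ∈ {1, 2}` — 18 distinct triples; verdicts agree with column 37 `licence_cell_tame` cell by cell (HOLD at `k ≤ 3` and all
concrete rows, FAIL at `j = 2`, `k ≥ 4`). [folklore] -/
theorem k1_cells_v21 :
    Cell 5 1 1 ∧ Cell 5 1 2 ∧ Cell 5 2 1 ∧ Cell 5 2 2 ∧ Cell 5 3 1 ∧ Cell 5 3 2 ∧ Cell 5 4 1 ∧ ¬ Cell 5 4 2 ∧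
      Cell 5 6 1 ∧ ¬ Cell 5 6 2 ∧ Cell 5 7 1 ∧ ¬ Cell 5 7 2 ∧ Cell 5 8 1 ∧ ¬ Cell 5 8 2 ∧ Cell 5 9 1 ∧ ¬ Cell 5 9 2 ∧
      Cell 2 1 1 ∧ Cell 2 1 2 := by
  simp only [Cell]
  decide

/-- **k1 KERNEL BLOCK, sample of the Szpiro-bad Frey tame rows** joined by abc-iut-rh-num-1 (16:57Z) — binding label `j = l⋆`, one
representative per `H`-class: `H = 2` (`P = 15`: `(1605, 15, 53)`, `(165, 15, 5)`) and `H = 4` (`(1545, 30, 51)`) HOLD; `H = 6`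
(`(115, 15, 11)`), `H = 10` (`(321, 15, 53)`), `H = 18` (`(65, 45, 6)`) FAIL. The full family is evaluated seat-side in exact integers
(HOME/abc-iut-rh-typ-5/k1). [folklore] -/
theorem k1_cells_frey_sample :
    Cell 1605 15 53 ∧ Cell 165 15 5 ∧ Cell 1545 30 51 ∧ ¬ Cell 115 15 11 ∧ ¬ Cell 321 15 53 ∧ ¬ Cell 65 45 6 := by
  simp only [Cell]
  decide

/-! ## §2. The deciding decl over the genuine `K`-level datum -/

variable {F K Fbar : Type} [Field F] [NumberField F] [Field K] [NumberField K] [Algebra F K] [Field Fbar]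
  [Algebra F Fbar] [Algebra K Fbar] {E : WeierstrassCurve F} [E.IsElliptic] {l : ℕ} {Pb : BadPlacePredicates K}

/-- **H⋆₅ «tame-band-licence» — the deciding decl of RH-CANDIDATES row 5** [R-H candidate, hypothesis — not a fact]. At the genuine
`K`-level datum `pilotDataOfK D K` of an initial Θ-datum `D` ([IUTchI] Def. 3.1): for every prime `p`, every label `j = i+1 ∈ 𝔽_l^⋇` and
every place `w ∣ p` of `K` that is BAD (`w ∈ S`) and TAME (`p > 2`, `e_w = e(w|p) ≤ p − 2`), with `P_w ∈ ℕ` the integral q-degree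
(`qPilot w = P_w`; `2l·P_w = e(w|v)·ord_v(q_v)`, `Cor312Prov.exists_nat_qPilot_pilotDataOfK`): `(j²−1)·P_w ≤ j·(e_w−1) + ((j²·P_w − 1) mod e_w)`.
Quoting the row: «on TAME bad packets (e_w < p-1, or ball places): forall j: (j^2-1)*m_q <= j*(e_w-1) + ((j^2*m_q - 1) mod e_w) (theta_j = j
end of the band); no claim at wild packets». The «or ball places» rider is not typed (no tree licence decision at boundary packets).
[cite: Mochizuki2012, IUTchI Ex. 3.2 (iv) p. 71; IUTchIV Prop. 1.2 (i)(ii) p. 10] [cite: DupuyHilado2025, §3.3, §3.4, §4.9]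
[claim: Mochizuki2012, status: disputed] -/
@[claim "Mochizuki2012" "disputed"]
def HStarTameBandLicence (D : InitialThetaData F K Fbar E l Pb) : Prop :=
  ∀ (pp : Nat.Primes) (i : Fin (pilotDataOfK D K).lstar) (w : (thetaIndex (pilotDataOfK D K)).Fibre (.inr pp)),
    haveI : Fact (pp : ℕ).Prime := ⟨pp.2⟩
    placeOf (pilotDataOfK D K) pp.1 w ∈ (pilotDataOfK D K).S →
      2 < (pp : ℕ) → (placeOf (pilotDataOfK D K) pp.1 w).asIdeal.ramificationIdx ℤ ≤ (pp : ℕ) - 2 →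
        ∀ P : ℕ, (pilotDataOfK D K).qPilot (placeOf (pilotDataOfK D K) pp.1 w) = P →
          Cell (((placeOf (pilotDataOfK D K) pp.1 w).asIdeal.ramificationIdx ℤ : ℕ) : ℤ) (P : ℤ) (((i : ℕ) + 1 : ℕ) : ℤ)

variable (D : InitialThetaData F K Fbar E l Pb)

/-- Unfolding lemma for `HStarTameBandLicence`. [folklore] -/
theorem hStar_iff :
    HStarTameBandLicence D ↔
      ∀ (pp : Nat.Primes) (i : Fin (pilotDataOfK D K).lstar) (w : (thetaIndex (pilotDataOfK D K)).Fibre (.inr pp)),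
        haveI : Fact (pp : ℕ).Prime := ⟨pp.2⟩
        placeOf (pilotDataOfK D K) pp.1 w ∈ (pilotDataOfK D K).S →
          2 < (pp : ℕ) → (placeOf (pilotDataOfK D K) pp.1 w).asIdeal.ramificationIdx ℤ ≤ (pp : ℕ) - 2 →
            ∀ P : ℕ, (pilotDataOfK D K).qPilot (placeOf (pilotDataOfK D K) pp.1 w) = P →
              Cell (((placeOf (pilotDataOfK D K) pp.1 w).asIdeal.ramificationIdx ℤ : ℕ) : ℤ) (P : ℤ) (((i : ℕ) + 1 : ℕ) : ℤ) :=
  Iff.rfl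

/-- **A bad place that is unramified and odd (`e_w = 1`, `p > 2`) REFUTES H⋆₅ as typed** (label `j = 2 ≤ l⋆`, `P_w ≥ 1`, `not_cell_one`):
on the unramified-odd stratum H⋆₅ agrees with the NEG family of record and with the licence's own refutation — no false positive there.
[cite: Mochizuki2012, IUTchI Ex. 3.2 (iv) p. 71] [claim: Mochizuki2012, status: disputed] -/
theorem not_hStar_of_unramified_bad (pp : Nat.Primes) (w : (thetaIndex (pilotDataOfK D K)).Fibre (.inr pp)) (hp2 : 2 < (pp : ℕ))
    (hw : haveI : Fact (pp : ℕ).Prime := ⟨pp.2⟩; placeOf (pilotDataOfK D K) pp.1 w ∈ (pilotDataOfK D K).S)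
    (he : haveI : Fact (pp : ℕ).Prime := ⟨pp.2⟩; (placeOf (pilotDataOfK D K) pp.1 w).asIdeal.ramificationIdx ℤ = 1) :
    ¬ HStarTameBandLicence D := by
  haveI : Fact (pp : ℕ).Prime := ⟨pp.2⟩
  intro h
  obtain ⟨P, hP, hP1, -⟩ := exists_nat_qPilot_pilotDataOfK D hw
  have hl : 1 < (pilotDataOfK D K).lstar := lt_of_lt_of_le one_lt_two (pilotDataOfK D K).two_le_lstar
  have hc := h pp ⟨1, hl⟩ w hw hp2 (by rw [he]; omega) P hP
  rw [he, Nat.cast_one] at hc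
  exact not_cell_one (by exact_mod_cast hP1) (by norm_num) hc

/-! ## §3. At the window bed: the declared stratum-equivalence with the licence, the k2 door, and «weaker than I06⋆» -/

variable {logv : PadicLogs K} (hlog : LogvAnalytic logv)
  (M : Type) [Field M] [NumberField M]
  (archPk : ∀ (j : (thetaIndex (pilotDataOfK D K)).Label) (vQ : (thetaIndex (pilotDataOfK D K)).VQ),
    Set ((logShellsDH (pilotDataOfK D K) logv).Packet j vQ))
  (archSub : ∀ (j : (thetaIndex (pilotDataOfK D K)).Label) (v : (thetaIndex (pilotDataOfK D K)).V),
    Set ((logShellsDH (pilotDataOfK D K) logv).Packet j ((thetaIndex (pilotDataOfK D K)).over v)))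
  (Ψ : ℤ → ∀ v : (thetaIndex (pilotDataOfK D K)).V, v ∈ (thetaIndex (pilotDataOfK D K)).Vbad →
    Set ((logShellsDH (pilotDataOfK D K) logv).StarPacket v))
  (act : ℤ → ∀ v : (thetaIndex (pilotDataOfK D K)).V, v ∈ (thetaIndex (pilotDataOfK D K)).Vbad →
    (logShellsDH (pilotDataOfK D K) logv).StarPacket v → Module.End ℚ ((logShellsDH (pilotDataOfK D K) logv).StarPacket v))
  (Mmod : ℤ → ∀ j : (thetaIndex (pilotDataOfK D K)).LabelStar, Set ((logShellsDH (pilotDataOfK D K) logv).GlobalPacket j.1))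
  (region : ℤ → ∀ j : (thetaIndex (pilotDataOfK D K)).LabelStar, FinDivisor M → ∀ vQ : (thetaIndex (pilotDataOfK D K)).VQ,
    Set ((logShellsDH (pilotDataOfK D K) logv).Packet j.1 vQ))
  (n : ℤ) {HT : Type} {LogLink : HT → HT → Type} {IsFull : ∀ {s t : HT}, LogLink s t → Prop}
  (lat : LGPGaussianLogThetaLattice LogLink IsFull)
  {Frd : Type} {IsoF : Frd → Frd → Type} {Ob : Frd → Type} {realify : Frd → Frd} {Strip : Type}
  {IsoS : Strip → Strip → Type} {Mv : ∀ v : (thetaIndex (pilotDataOfK D K)).V, v ∈ (thetaIndex (pilotDataOfK D K)).Vbad → Type}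
  [∀ v h, Monoid (Mv v h)]
  (sig : GlobalLGPFrobenioidSignature (thetaIndex (pilotDataOfK D K)).lstar (thetaIndex (pilotDataOfK D K)).V
    (· ∈ (thetaIndex (pilotDataOfK D K)).Vbad) Frd IsoF Ob realify Strip IsoS Mv)
  (split : SplittingMonoids Mv) {ObΔ : Type} {N : ∀ v : (thetaIndex (pilotDataOfK D K)).V, v ∈ (thetaIndex (pilotDataOfK D K)).Vbad → Type}
  [∀ v h, Monoid (N v h)] (qData : QPilotData ObΔ N)
  (tq : ∀ (pp : Nat.Primes) (x : (thetaIndex (pilotDataOfK D K)).Fibre (.inr pp)),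
    haveI : Fact (pp : ℕ).Prime := ⟨pp.2⟩; kOf (pilotDataOfK D K) pp.1 x)
  (t : ∀ (pp : Nat.Primes) (_ : Fin (pilotDataOfK D K).lstar) (x : (thetaIndex (pilotDataOfK D K)).Fibre (.inr pp)),
    haveI : Fact (pp : ℕ).Prime := ⟨pp.2⟩; kOf (pilotDataOfK D K) pp.1 x)
  (htq0 : ∀ pp x, tq pp x ≠ 0)
  (htq1 : ∀ (pp : Nat.Primes) (x : (thetaIndex (pilotDataOfK D K)).Fibre (.inr pp)),
    haveI : Fact (pp : ℕ).Prime := ⟨pp.2⟩; placeOf (pilotDataOfK D K) pp.1 x ∉ (pilotDataOfK D K).S → ‖tq pp x‖ = 1)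
  (col : ℤ → Column (logShellsDH (pilotDataOfK D K) logv))
  (ht0 : ∀ pp i x, t pp i x ≠ 0)
  (ht : ∀ (pp : Nat.Primes) (i : Fin (pilotDataOfK D K).lstar) (x : (thetaIndex (pilotDataOfK D K)).Fibre (.inr pp)),
    haveI : Fact (pp : ℕ).Prime := ⟨pp.2⟩
    Real.log ‖t pp i x‖ = -((pilotDataOfK D K).thetaPilot i (placeOf (pilotDataOfK D K) pp.1 x)) *
      logNorm K (placeOf (pilotDataOfK D K) pp.1 x) / localDegree K (placeOf (pilotDataOfK D K) pp.1 x))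
  (htq : ∀ (pp : Nat.Primes) (x : (thetaIndex (pilotDataOfK D K)).Fibre (.inr pp)),
    haveI : Fact (pp : ℕ).Prime := ⟨pp.2⟩
    Real.log ‖tq pp x‖ = -((pilotDataOfK D K).qPilot (placeOf (pilotDataOfK D K) pp.1 x)) *
      logNorm K (placeOf (pilotDataOfK D K) pp.1 x) / localDegree K (placeOf (pilotDataOfK D K) pp.1 x))

/-- Positivity of the absolute ramification index at a fibre point of the genuine datum (through the completion,
`absRamificationIdx_rescaledCompletion`). [folklore] -/
theorem ramificationIdx_placeOf_pos (pp : Nat.Primes) (w : (thetaIndex (pilotDataOfK D K)).Fibre (.inr pp)) :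
    haveI : Fact (pp : ℕ).Prime := ⟨pp.2⟩
    0 < (placeOf (pilotDataOfK D K) pp.1 w).asIdeal.ramificationIdx ℤ := by
  haveI : Fact (pp : ℕ).Prime := ⟨pp.2⟩
  have h0 := absRamificationIdx_pos (pp : ℕ) (kOf (pilotDataOfK D K) pp.1 w)
  rwa [absRamificationIdx_rescaledCompletion K (pp : ℕ) (placeOf (pilotDataOfK D K) pp.1 w)
    (natCast_mem_placeOf (pilotDataOfK D K) pp.1 w)] at h0

include ht0 ht htq in
/-- **THE DECLARED STRATUM-EQUIVALENCE (START-HERE §3, k4 amended): at a genuine datum all of whose bad fibres are uniformly tame, for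
REALISING Θ- and q-ideles, the (xi-f) licence at the window bed `settingPrVolSharp (pilotDataOfK D K) …` holds IFF H⋆₅ holds** — abc-iut-w5-d009's
`Cor312Prov.licence_settingPrVolSharp_pilotDataOfK_iff_of_tame` read through `cell_iff_tame_exact`. So on the tame stratum k1(H⋆₅) equals the
(L2) ceiling exactly; the candidate's content is the faithfulness of the band end `θ_j = j`, not a weakening of S_H.
[cite: Mochizuki2012, IUTchI Ex. 3.2 (iv) p. 71; IUTchIII Step (xi-f) p. 184; IUTchIV Prop. 1.2 (i)(ii) p. 10] [cite: DupuyHilado2025, §3.3, §3.4, §4.9]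
[claim: Mochizuki2012, status: disputed] -/
theorem licence_settingPrVolSharp_pilotDataOfK_iff_hStar_of_tame (e : Nat.Primes → ℕ)
    (htame : ∀ (pp : Nat.Primes) (x : (thetaIndex (pilotDataOfK D K)).Fibre (.inr pp)),
      haveI : Fact (pp : ℕ).Prime := ⟨pp.2⟩
      (∃ w : (thetaIndex (pilotDataOfK D K)).Fibre (.inr pp), placeOf (pilotDataOfK D K) pp.1 w ∈ (pilotDataOfK D K).S) →
        2 < (pp : ℕ) ∧ e pp ≤ (pp : ℕ) - 2 ∧ (placeOf (pilotDataOfK D K) pp.1 x).asIdeal.ramificationIdx ℤ = e pp) :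
    Thm311ToCor312.Licence
        (settingPrVolSharp (pilotDataOfK D K) hlog M archPk archSub Ψ act Mmod region n lat sig split qData tq t htq0 htq1) ↔
      HStarTameBandLicence D := by
  rw [licence_settingPrVolSharp_pilotDataOfK_iff_of_tame D hlog M archPk archSub Ψ act Mmod region n lat sig split qData tq t htq0
    htq1 ht0 ht htq e htame, hStar_iff]
  constructor
  · intro h pp i w hw hp2 hew P hP
    haveI : Fact (pp : ℕ).Prime := ⟨pp.2⟩
    obtain ⟨-, -, hram⟩ := htame pp w ⟨w, hw⟩
    have he0 : (0 : ℤ) < ((placeOf (pilotDataOfK D K) pp.1 w).asIdeal.ramificationIdx ℤ : ℤ) := by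
      exact_mod_cast ramificationIdx_placeOf_pos D pp w
    have h1 := h pp i w hw P hP
    rw [← hram] at h1
    refine (cell_iff_tame_exact he0 _ _).2 ?_
    push_cast at h1 ⊢
    linarith
  · intro h pp i w hw P hP
    haveI : Fact (pp : ℕ).Prime := ⟨pp.2⟩
    obtain ⟨hp2, hep, hram⟩ := htame pp w ⟨w, hw⟩
    have he0 : (0 : ℤ) < ((placeOf (pilotDataOfK D K) pp.1 w).asIdeal.ramificationIdx ℤ : ℤ) := by
      exact_mod_cast ramificationIdx_placeOf_pos D pp w
    have h1 := h pp i w hw hp2 (by rw [hram]; exact hep) P hP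
    have h2 := (cell_iff_tame_exact he0 _ _).1 h1
    rw [hram] at h2
    push_cast at h2 ⊢
    linarith

include ht0 ht htq in
/-- **THE k2 DOOR (START-HERE §3 (k2) target shape, §8 A2 (a)): H⋆₅ ⟹ branch C's per-datum S_H antecedent «∃ ρ qK, QPinned ∧
PilotKummerCompatHull» at `settingPrVolSharp (pilotDataOfK D K) …`** (all bad fibres uniformly tame, realising ideles; any columns `col`) —
through the licence (abc-iut-w5-d009 `exists_qPinned_and_hull_settingPrVolSharp_iff_licence`, q-ideles of norm `≤ 1` by abc-iut-w5-d236
`norm_qIdele_le_one_of_realises`). [cite: Mochizuki2012, IUTchIII Step (xi) (xi-f) p. 184] [cite: DupuyHilado2025, §3.3, §3.4, §3.9, §4.9]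
[claim: Mochizuki2012, status: disputed] -/
theorem exists_qPinned_and_hull_settingPrVolSharp_pilotDataOfK_of_hStar_of_tame (e : Nat.Primes → ℕ)
    (htame : ∀ (pp : Nat.Primes) (x : (thetaIndex (pilotDataOfK D K)).Fibre (.inr pp)),
      haveI : Fact (pp : ℕ).Prime := ⟨pp.2⟩
      (∃ w : (thetaIndex (pilotDataOfK D K)).Fibre (.inr pp), placeOf (pilotDataOfK D K) pp.1 w ∈ (pilotDataOfK D K).S) →
        2 < (pp : ℕ) ∧ e pp ≤ (pp : ℕ) - 2 ∧ (placeOf (pilotDataOfK D K) pp.1 x).asIdeal.ramificationIdx ℤ = e pp)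
    (hH : HStarTameBandLicence D) :
    ∃ (ρ : (∀ v : (thetaIndex (pilotDataOfK D K)).V, v ∈ (thetaIndex (pilotDataOfK D K)).Vbad →
            Set ((logShellsDH (pilotDataOfK D K) logv).StarPacket v)) →
          ∀ (j : (thetaIndex (pilotDataOfK D K)).Label) (vQ : (thetaIndex (pilotDataOfK D K)).VQ),
            Set ((logShellsDH (pilotDataOfK D K) logv).Packet j vQ))
        (qK : ∀ v : (thetaIndex (pilotDataOfK D K)).V, v ∈ (thetaIndex (pilotDataOfK D K)).Vbad →
          Set ((logShellsDH (pilotDataOfK D K) logv).StarPacket v)),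
        QPinned ({ toSituation := situationPrVol (pilotDataOfK D K) hlog M archPk archSub Ψ act Mmod region, col := col } :
            LatticeSituation (thetaIndex (pilotDataOfK D K)))
          (settingPrVolSharp (pilotDataOfK D K) hlog M archPk archSub Ψ act Mmod region n lat sig split qData tq t htq0 htq1) ρ qK ∧
        PilotKummerCompatHull ({ toSituation := situationPrVol (pilotDataOfK D K) hlog M archPk archSub Ψ act Mmod region, col := col } :
            LatticeSituation (thetaIndex (pilotDataOfK D K)))
          (settingPrVolSharp (pilotDataOfK D K) hlog M archPk archSub Ψ act Mmod region n lat sig split qData tq t htq0 htq1) ρ qK :=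
  (exists_qPinned_and_hull_settingPrVolSharp_iff_licence (pilotDataOfK D K) hlog M archPk archSub Ψ act Mmod region n lat sig split qData
      tq t htq0 htq1 col (fun pp x => norm_qIdele_le_one_of_realises (pilotDataOfK D K) tq htq0 htq pp x)).2
    ((licence_settingPrVolSharp_pilotDataOfK_iff_hStar_of_tame D hlog M archPk archSub Ψ act Mmod region n lat sig split qData tq t htq0
      htq1 ht0 ht htq e htame).2 hH)

include htq0 htq in
/-- **H⋆₅ IS WEAKER THAN RP-I06⋆ ON THE TAME STRATUM**: for a REALISING q-idele `tq`, the real I06⋆ cells `t_{q,w} ∈ t_{q,w}^{j²}·ℐ_{K_w}` at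
the TAME bad places (abc-iut-rp-d2 `CandInternal2RealLabels`, integer form abc-iut-w5-d068
`mem_pow_smul_logShell_qIdele_pilotDataOfK_iff_of_tame`: `(j²−1)·P_w ≤ e_w − 1`) imply H⋆₅ (`cell_of_quadratic`); the converse fails
(`k4_witnesses`: S-X72). [cite: MochizukiAbsTopIII2015, Def 5.4 (iii) p. 126] [cite: DupuyHilado2025, §3.4] [claim: Mochizuki2012, status: disputed] -/
theorem hStar_of_realStar_tame
    (hstar : ∀ (pp : Nat.Primes) (i : Fin (pilotDataOfK D K).lstar) (w : (thetaIndex (pilotDataOfK D K)).Fibre (.inr pp)),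
      haveI : Fact (pp : ℕ).Prime := ⟨pp.2⟩
      placeOf (pilotDataOfK D K) pp.1 w ∈ (pilotDataOfK D K).S → 2 < (pp : ℕ) →
        (placeOf (pilotDataOfK D K) pp.1 w).asIdeal.ramificationIdx ℤ ≤ (pp : ℕ) - 2 →
          tq pp w ∈ tq pp w ^ (((i : ℕ) + 1) ^ 2) • logShell (PadicLogOnUnits.ofUnitLog (pp : ℕ) (kOf (pilotDataOfK D K) pp.1 w))) :
    HStarTameBandLicence D := by
  intro pp i w hw hp2 hew P hP
  haveI : Fact (pp : ℕ).Prime := ⟨pp.2⟩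
  have he1 : (1 : ℤ) ≤ ((placeOf (pilotDataOfK D K) pp.1 w).asIdeal.ramificationIdx ℤ : ℤ) := by
    have := ramificationIdx_placeOf_pos D pp w
    omega
  have hle := (mem_pow_smul_logShell_qIdele_pilotDataOfK_iff_of_tame D tq htq0 htq pp w hp2 hew rfl hP (((i : ℕ) + 1) ^ 2)).1
    (hstar pp i w hw hp2 hew)
  refine cell_of_quadratic he1 (by push_cast; omega) ?_
  push_cast at hle ⊢
  linarith

end Summit.ABC.IUTFork.Repair.RH.TameBandLicence

end
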